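import Literature.AlgebraicGeometry.Resolution.ProjectiveModels
import Literature.AlgebraicGeometry.Resolution.AlterationsStrictTransformModel
import Literature.AlgebraicGeometry.Motives.SegreEmbedding
import Mathlib.AlgebraicGeometry.Morphisms.Separated
import HarnessLib

/-!
# Domination of projective models: uniqueness, the closure of a `K`-point, the join, and
# isomorphy over the domain of definition

Topic: `Literature/AlgebraicGeometry/Resolution`. Bookkeeping for Zariski's patching of
projective models (Zariski–Samuel II, Ch. VI §17: domination `M ≤ M'` of models and the JOIN of
two models; Piltant 2013, proof of Prop. 5.1, Step 2: "let `Z` be the … closure of the graph of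
`η : X₂ ⋯→ X₁`, so `Z` dominates both of `X₁` and `X₂`", Lemma 3.3: "Let `Y` be the closure of
the graph of the rational map `X' ⋯→ X`. Then `Y` dominates `X`, and `Y` is locally isomorphic to
`X'` at `x'_V`" (i.e. over the open where the rational map is defined), and Step 5), on the
projective models `ProjModel k K` of `ProjectiveModels.lean`. Everything here is PROVED:

* `ProjModel.isDominant_gen`, `ProjModel.Hom.f_eq`, `ProjModel.Hom.eq` — the `K`-point of a
  model is dominant, so a model dominates another in at most one way (two `k`-morphisms agreeing
  at the generic point of a reduced source into a separated target coincide).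
* `ProjModel.Hom.isIso_morphismRestrict_of_section` — if `φ : N → M` admits over the open
  `U ⊆ M` a dominant section `U → N`, then `φ` is an isomorphism over `U`
  (`ChowLemmaProof.isIso_morphismRestrict_of_section`: a dominant section of a separated
  morphism from a reduced scheme).
* `ProjModel.ofClosure` — the CLOSURE MODEL: for a projective `k`-scheme `Q`, a `K`-point
  `rl : Spec K → Q` and a `k`-morphism `s : Q → M` to a projective model with `rl ≫ s = gen_M`, the
  scheme-theoretic image of `rl` is a projective model of `K/k` (integral, projective, with
  function field `K`), dominating every model `M'` under `Q` compatibly with `rl`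
  (`ProjModel.ofClosure.homOf`).
* `ProjModel.ofClosure.isIso_homOf_morphismRestrict` — MAIN: if over an open `U ⊆ M'` there is a
  section `f : U → Q` of `Q → M'` passing through the `K`-point, then the closure model is
  isomorphic to `M'` over `U` (the closure of the graph of a rational map is isomorphic to the
  source over the domain of definition; Piltant 2013, Lemma 3.3).
* `ProjModel.join M₁ M₂` with `joinFst`, `joinSnd` — the join (closure of the diagonal `K`-point
  in `M₁ ×ₖ M₂`), now as a definition (cf. `ProjModel.exists_join`, `ProjectiveModelsJoin.lean`),
  and `ProjModel.isIso_joinFst_morphismRestrict` / `isIso_joinSnd_morphismRestrict`: the join is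
  isomorphic to `M₁` over every open `U ⊆ M₁` on which the birational correspondence
  `M₁ ⋯→ M₂` is a morphism (a `k`-morphism `U → M₂` compatible with the `K`-points), and
  symmetrically.

## References

* O. Zariski, P. Samuel, *Commutative Algebra* II, Ch. VI §17 (domination, joins of models).
  [ZariskiSamuel1960]
* O. Piltant, *An axiomatic version of Zariski's patching theorem*, RACSAM 107 (2013) 91–121,
  Lemma 3.3 and proof of Prop. 5.1, Steps 2 and 5. [Piltant2013]
* U. Görtz, T. Wedhorn, *Algebraic Geometry I*, 2nd ed. (2020), proof of Thm. 13.100, Step 3.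
  [GortzWedhorn2020]
-/

noncomputable section

open CategoryTheory CategoryTheory.Limits AlgebraicGeometry TopologicalSpace IsLocalRing
  MonoidalCategory CartesianMonoidalCategory

namespace Literature.AlgebraicGeometry.Resolution

namespace ProjModel

universe u

variable {k K : Type u} [Field k] [Field K] [Algebra k K]

/-! ## The `K`-point of a model is dominant; domination is unique -/

/-- The range of the `K`-point of a projective model is the generic point. [folklore] -/
theorem range_gen (M : ProjModel k K) : Set.range M.gen = {genericPoint M.X} := by
  ext z
  constructor
  · rintro ⟨p, rfl⟩
    rw [eq_closedPoint_of_field p]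
    exact M.genericPt_eq
  · intro hz
    exact ⟨closedPoint K, M.genericPt_eq.trans (Set.mem_singleton_iff.mp hz).symm⟩

/-- The `K`-point `Spec K → M` of a projective model is dominant (it is the generic point).
[folklore] -/
instance isDominant_gen (M : ProjModel k K) : IsDominant M.gen := by
  refine ⟨?_⟩
  show Dense (Set.range M.gen)
  rw [range_gen, dense_iff_closure_eq]
  exact genericPoint_spec M.X

/-- **Uniqueness of domination**: two morphisms of projective models `N → M` have the same
underlying morphism — both are `k`-morphisms from the integral `N` to the separated `M` agreeing
at the generic point (Zariski–Samuel II, Ch. VI §17: `M ≤ M'` is a RELATION).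
[cite: ZariskiSamuel1960, Ch. VI §17] -/
theorem Hom.f_eq {N M : ProjModel k K} (φ ψ : N.Hom M) : φ.f = ψ.f :=
  ext_of_isDominant_of_isSeparated M.π (by rw [φ.f_π, ψ.f_π]) N.gen (by rw [φ.gen_f, ψ.gen_f])

/-- Hence morphisms of projective models `N → M` are unique. [cite: ZariskiSamuel1960, Ch. VI §17] -/
theorem Hom.eq {N M : ProjModel k K} (φ ψ : N.Hom M) : φ = ψ := by
  have h := Hom.f_eq φ ψ
  obtain ⟨f, _, _⟩ := φ
  obtain ⟨g, _, _⟩ := ψ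
  simp only at h
  subst h
  rfl

/-- Morphisms of projective models form a subsingleton. [folklore] -/
instance subsingleton_hom (N M : ProjModel k K) : Subsingleton (N.Hom M) :=
  ⟨Hom.eq⟩

/-! ## A dominant section over an open forces an isomorphism there -/

/-- **A dominant section over an open forces an isomorphism**: if the morphism of models
`φ : N → M` admits over the open `U ⊆ M` a section `h : U → N` (`h ≫ φ = U ↪ M`) with dense
image, then `φ⁻¹(U) → U` is an isomorphism (Görtz–Wedhorn, proof of Thm. 13.100, Step 3: the
corestriction of `h` is a section of a separated morphism, hence a closed immersion, dominant
into a reduced scheme, hence an isomorphism). [cite: GortzWedhorn2020, Thm 13.100 (proof, Step 3)] -/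
theorem Hom.isIso_morphismRestrict_of_section {N M : ProjModel k K} (φ : N.Hom M)
    (U : M.X.Opens) (h : (U : Scheme.{u}) ⟶ N.X) [IsDominant h] (w : h ≫ φ.f = U.ι) :
    IsIso (φ.f ∣_ U) :=
  (ChowLemmaProof.isIso_morphismRestrict_of_section φ.f U h w).1

/-- A morphism into a projective model through which the `K`-point factors is dominant.
[folklore] -/
theorem isDominant_of_comp_eq_gen {N : ProjModel k K} {Z : Scheme.{u}} (h : Z ⟶ N.X)
    (s : Spec (CommRingCat.of K) ⟶ Z) (hs : s ≫ h = N.gen) : IsDominant h := by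
  have : IsDominant (s ≫ h) := by rw [hs]; infer_instance
  exact IsDominant.of_comp s h

/-! ## The closure of a `K`-point in a projective `k`-scheme is a projective model -/

/-- `Spec` of a field is a Noetherian space. [folklore] -/
instance noetherianSpace_specField : NoetherianSpace (Spec (CommRingCat.of K)) :=
  inferInstanceAs (NoetherianSpace (PrimeSpectrum K))

section Closure

variable (M : ProjModel k K) {Q : Motives.SchemeOver k} (hQ : Motives.IsProjectiveOver Q)
  (rl : Spec (CommRingCat.of K) ⟶ Q.left) (s : Q.left ⟶ M.X) (hs : s ≫ M.π = Q.hom)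
  (hr : rl ≫ s = M.gen)

/-- The scheme-theoretic image of a `K`-point is integral. [folklore] -/
instance isIntegral_image_point : IsIntegral rl.image :=
  ChowLemmaProof.isIntegral_image rl

omit [Algebra k K] in
/-- The image of `Spec K` in the scheme-theoretic image of a `K`-point is its generic point.
[folklore] -/
theorem toImage_closedPoint : rl.toImage (closedPoint K) = genericPoint rl.image := by
  let g := rl.toImage
  have hdense : Dense (Set.range g) := (inferInstance : IsDominant g).denseRange
  have hrange : Set.range g = {g (closedPoint K)} := by
    ext z
    constructor
    · rintro ⟨p, rfl⟩
      rw [eq_closedPoint_of_field p]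
      rfl
    · intro hz
      exact ⟨_, hz.symm⟩
  have hgen : IsGenericPoint (g (closedPoint K)) (⊤ : Set rl.image) := by
    change closure {g (closedPoint K)} = (Set.univ : Set rl.image)
    rw [← hrange]
    exact hdense.closure_eq
  exact ((genericPoint_spec rl.image).eq hgen).symm

include hs hr in
omit hs in
/-- `𝒪_{Z,ξ} → K` is an isomorphism for the closure `Z` of a `K`-point `rl` with `rl ≫ s = gen_M`:
`𝒪_{M,ξ} → K` is one and factors through it. [folklore] -/
theorem isIso_stalkClosedPointTo_toImage : IsIso (Scheme.stalkClosedPointTo rl.toImage) := by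
  let g := rl.toImage
  let c := rl.imageι
  have hgc : g ≫ c = rl := Scheme.Hom.toImage_imageι rl
  have e : g ≫ (c ≫ s) = M.gen := by rw [reassoc_of% hgc, hr]
  have h1 : IsIso (Scheme.stalkClosedPointTo (g ≫ (c ≫ s))) := by
    rw [e]
    infer_instance
  rw [Scheme.stalkClosedPointTo_comp] at h1
  have hsurj : Function.Surjective (Scheme.stalkClosedPointTo g).hom := by
    obtain ⟨w, -, hw⟩ := h1.out
    intro y
    have h2 := congrArg (fun φ => φ.hom y) hw
    exact ⟨_, h2⟩
  have hF : IsField (rl.image.presheaf.stalk (g (closedPoint K))) := by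
    rw [show g (closedPoint K) = genericPoint rl.image from toImage_closedPoint rl]
    exact Field.toIsField _
  letI := hF.toField
  exact (ConcreteCategory.isIso_iff_bijective _).mpr
    ⟨(Scheme.stalkClosedPointTo g).hom.injective, hsurj⟩

include hs hr in
/-- The `K`-point `rl` lies over `Spec K → Spec k`. [folklore] -/
theorem point_comp_hom : rl ≫ Q.hom = Spec.map (CommRingCat.ofHom (algebraMap k K)) := by
  rw [← hs, reassoc_of% hr, M.gen_π]

/-- **The closure model** of a `K`-point `rl : Spec K → Q` of a projective `k`-scheme `Q` lying
over the generic point of a projective model `M` (through a `k`-morphism `s : Q → M` with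
`rl ≫ s = gen_M`): the scheme-theoretic image of `rl`, an integral closed subscheme of `Q`,
projective over `k`, whose generic point is the image of `Spec K` and whose function field is `K`
(Zariski–Samuel II, Ch. VI §17; Piltant 2013, proof of Prop. 5.1, Step 2 and Lemma 3.3: closures
of graphs of rational maps). [cite: ZariskiSamuel1960, Ch. VI §17] -/
def ofClosure : ProjModel k K where
  X := rl.image
  π := rl.imageι ≫ Q.hom
  gen := rl.toImage
  gen_π := by rw [Scheme.Hom.toImage_imageι_assoc, point_comp_hom M rl s hs hr]
  isIntegral := inferInstance
  isProjectiveOver := by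
    obtain ⟨m, ε, hε⟩ := hQ
    haveI := hε
    have hιε : (rl.imageι ≫ ε.left) ≫ (Motives.projectiveSpace m k).hom = rl.imageι ≫ Q.hom := by
      rw [Category.assoc, Over.w ε]
    exact ⟨m, Over.homMk (rl.imageι ≫ ε.left) hιε,
      inferInstanceAs (IsClosedImmersion (rl.imageι ≫ ε.left))⟩
  genericPt_eq := toImage_closedPoint rl
  isIso_stalkClosedPointTo := isIso_stalkClosedPointTo_toImage M rl s hr

/-- The underlying scheme of the closure model is the scheme-theoretic image. [folklore] -/
@[simp]
theorem ofClosure_X : (ofClosure M hQ rl s hs hr).X = rl.image := rfl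

/-- The `K`-point of the closure model is `rl.toImage`. [folklore] -/
@[simp]
theorem ofClosure_gen : (ofClosure M hQ rl s hs hr).gen = rl.toImage := rfl

/-- The structure morphism of the closure model. [folklore] -/
@[simp]
theorem ofClosure_π : (ofClosure M hQ rl s hs hr).π = rl.imageι ≫ Q.hom := rfl

/-- **The closure model dominates every model under `Q` compatibly with the `K`-point**: for a
`k`-morphism `s' : Q → M'` with `rl ≫ s' = gen_{M'}`, `Z ↪ Q → M'` is a morphism of models.
[cite: ZariskiSamuel1960, Ch. VI §17] -/
def ofClosure.homOf (M' : ProjModel k K) (s' : Q.left ⟶ M'.X) (hs' : s' ≫ M'.π = Q.hom)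
    (hr' : rl ≫ s' = M'.gen) : (ofClosure M hQ rl s hs hr).Hom M' where
  f := rl.imageι ≫ s'
  f_π := by
    show (rl.imageι ≫ s') ≫ M'.π = rl.imageι ≫ Q.hom
    rw [Category.assoc, hs']
  gen_f := by
    show rl.toImage ≫ rl.imageι ≫ s' = M'.gen
    rw [Scheme.Hom.toImage_imageι_assoc, hr']

/-- The underlying morphism of `ofClosure.homOf`. [folklore] -/
@[simp]
theorem ofClosure.homOf_f (M' : ProjModel k K) (s' : Q.left ⟶ M'.X) (hs' : s' ≫ M'.π = Q.hom)
    (hr' : rl ≫ s' = M'.gen) :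
    (ofClosure.homOf M hQ rl s hs hr M' s' hs' hr').f = rl.imageι ≫ s' := rfl

/-- The generic point of a non-empty open subscheme `U` of a projective model `M'`: a `K`-point of
`U` lying over `gen_{M'}` hits the generic point of `U`. [folklore] -/
theorem eq_genericPoint_of_comp_ι {M' : ProjModel k K} (U : M'.X.Opens)
    (sU : Spec (CommRingCat.of K) ⟶ (U : Scheme.{u})) (hsU : sU ≫ U.ι = M'.gen) :
    haveI : Nonempty (U : Scheme.{u}) := ⟨sU (closedPoint K)⟩
    haveI : IsIntegral (U : Scheme.{u}) := isIntegral_of_isOpenImmersion U.ι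
    sU (closedPoint K) = genericPoint (U : Scheme.{u}) := by
  haveI : Nonempty (U : Scheme.{u}) := ⟨sU (closedPoint K)⟩
  haveI : IsIntegral (U : Scheme.{u}) := isIntegral_of_isOpenImmersion U.ι
  apply U.ι.isOpenEmbedding.injective
  rw [genericPoint_eq_of_isOpenImmersion U.ι, ← Scheme.Hom.comp_apply, hsU]
  exact M'.genericPt_eq

/-- **The closure model is isomorphic to `M'` over the domain of definition** (Piltant 2013,
Lemma 3.3: "Let `Y` be the closure of the graph of the rational map `X' ⋯→ X`. Then `Y`
dominates `X`, and `Y` is locally isomorphic to `X'`" where the map is defined): if over the open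
`U ⊆ M'` there is a section `f : U → Q` of `s' : Q → M'` (`f ≫ s' = U ↪ M'`) through which the
`K`-point factors (`sU ≫ f = rl`), then `Z → M'` is an isomorphism over `U`. Proof: `U` is
integral with generic point `sU`, so `f(U) ⊆ closure {rl} = Z` and `f` lifts to a section
`U → Z` over `U` hitting the generic point of `Z`; conclude by
`Hom.isIso_morphismRestrict_of_section`. [cite: Piltant2013, Lemma 3.3] -/
theorem ofClosure.isIso_homOf_morphismRestrict (M' : ProjModel k K) (s' : Q.left ⟶ M'.X)
    (hs' : s' ≫ M'.π = Q.hom) (hr' : rl ≫ s' = M'.gen) (U : M'.X.Opens)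
    (f : (U : Scheme.{u}) ⟶ Q.left) (hf : f ≫ s' = U.ι) (sU : Spec (CommRingCat.of K) ⟶ U)
    (hsU : sU ≫ f = rl) :
    IsIso ((ofClosure.homOf M hQ rl s hs hr M' s' hs' hr').f ∣_ U) := by
  have hsUι : sU ≫ U.ι = M'.gen := by rw [← hf, reassoc_of% hsU, hr']
  haveI : Nonempty (U : Scheme.{u}) := ⟨sU (closedPoint K)⟩
  haveI : IsIntegral (U : Scheme.{u}) := isIntegral_of_isOpenImmersion U.ι
  have hη : sU (closedPoint K) = genericPoint (U : Scheme.{u}) :=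
    eq_genericPoint_of_comp_ι U sU hsUι
  -- `f(U) ⊆ closure {rl} = Z`
  have hrange : Set.range f ⊆ Set.range rl.imageι := by
    rw [Scheme.IdealSheafData.range_subschemeι, Scheme.Hom.support_ker]
    rintro _ ⟨u, rfl⟩
    have hu : u ∈ closure ({genericPoint (U : Scheme.{u})} : Set (U : Scheme.{u})) := by
      rw [genericPoint_closure]
      trivial
    have h1 : f u ∈ closure (f '' {genericPoint (U : Scheme.{u})}) :=
      map_mem_closure f.continuous hu fun x hx => Set.mem_image_of_mem f hx
    rw [Set.image_singleton, ← hη, ← Scheme.Hom.comp_apply, hsU] at h1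
    have hmem : rl (closedPoint K) ∈ Set.range rl := ⟨_, rfl⟩
    exact closure_mono (Set.singleton_subset_iff.mpr hmem) h1
  -- the section `U → Z`
  let h : (U : Scheme.{u}) ⟶ rl.image := IsClosedImmersion.liftOfRange rl.imageι f hrange
  have hw : h ≫ (rl.imageι ≫ s') = U.ι := by
    rw [← Category.assoc, IsClosedImmersion.liftOfRange_fac, hf]
  have hsh : sU ≫ h = rl.toImage := by
    rw [← cancel_mono rl.imageι, Category.assoc, IsClosedImmersion.liftOfRange_fac, hsU,
      Scheme.Hom.toImage_imageι]
  haveI : @IsDominant _ (ofClosure M hQ rl s hs hr).X h :=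
    isDominant_of_comp_eq_gen (N := ofClosure M hQ rl s hs hr) h sU hsh
  exact Hom.isIso_morphismRestrict_of_section (ofClosure.homOf M hQ rl s hs hr M' s' hs' hr')
    U h hw

end Closure

/-! ## The join of two projective models -/

section Join

/-- `Spec K` as a `k`-scheme. [folklore] -/
def specOverK (k K : Type u) [Field k] [Field K] [Algebra k K] : Motives.SchemeOver k :=
  Over.mk (Spec.map (CommRingCat.ofHom (algebraMap k K)))

/-- A projective model as a `k`-scheme (an object of `Over (Spec k)`). [folklore] -/
def toOver (M : ProjModel k K) : Motives.SchemeOver k :=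
  Over.mk M.π

/-- The underlying scheme of `M.toOver`. [folklore] -/
@[simp] theorem toOver_left (M : ProjModel k K) : M.toOver.left = M.X := rfl

/-- The structure morphism of `M.toOver`. [folklore] -/
@[simp] theorem toOver_hom (M : ProjModel k K) : M.toOver.hom = M.π := rfl

/-- The underlying scheme of `specOverK`. [folklore] -/
@[simp] theorem specOverK_left : (specOverK k K).left = Spec (CommRingCat.of K) := rfl

/-- The structure morphism of `specOverK`. [folklore] -/
@[simp] theorem specOverK_hom :
    (specOverK k K).hom = Spec.map (CommRingCat.ofHom (algebraMap k K)) := rfl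

/-- The `K`-point of a model as a morphism of `k`-schemes `Spec K → M`. [folklore] -/
def genOver (M : ProjModel k K) : specOverK k K ⟶ M.toOver :=
  Over.homMk M.gen M.gen_π

/-- The underlying morphism of `genOver`. [folklore] -/
@[simp] theorem genOver_left (M : ProjModel k K) : (genOver M).left = M.gen := rfl

variable (M₁ M₂ : ProjModel k K)

/-- The ambient product `M₁ ×ₖ M₂` of two projective models, a projective `k`-scheme (Segre).
[folklore] -/
abbrev joinAmbient : Motives.SchemeOver k :=
  M₁.toOver ⊗ M₂.toOver

/-- `M₁ ×ₖ M₂` is projective over `k` (Segre embedding,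
`Motives.IsProjectiveOver.tensor`). [folklore] -/
theorem isProjectiveOver_joinAmbient : Motives.IsProjectiveOver (joinAmbient M₁ M₂) :=
  M₁.isProjectiveOver.tensor M₂.isProjectiveOver

/-- The diagonal `K`-point `Spec K → M₁ ×ₖ M₂` as a morphism of `k`-schemes. [folklore] -/
def joinPointOver : specOverK k K ⟶ joinAmbient M₁ M₂ :=
  CartesianMonoidalCategory.lift (genOver M₁) (genOver M₂)

/-- The diagonal `K`-point `Spec K → M₁ ×ₖ M₂`, `(gen₁, gen₂)`. [folklore] -/
def joinPoint : Spec (CommRingCat.of K) ⟶ (joinAmbient M₁ M₂).left :=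
  (joinPointOver M₁ M₂).left

/-- The first projection `M₁ ×ₖ M₂ → M₁`. [folklore] -/
def joinAmbientFst : (joinAmbient M₁ M₂).left ⟶ M₁.X :=
  (CartesianMonoidalCategory.fst M₁.toOver M₂.toOver).left

/-- The second projection `M₁ ×ₖ M₂ → M₂`. [folklore] -/
def joinAmbientSnd : (joinAmbient M₁ M₂).left ⟶ M₂.X :=
  (CartesianMonoidalCategory.snd M₁.toOver M₂.toOver).left

/-- The first projection is a `k`-morphism. [folklore] -/
@[reassoc]
theorem joinAmbientFst_π : joinAmbientFst M₁ M₂ ≫ M₁.π = (joinAmbient M₁ M₂).hom :=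
  Over.w (CartesianMonoidalCategory.fst M₁.toOver M₂.toOver)

/-- The second projection is a `k`-morphism. [folklore] -/
@[reassoc]
theorem joinAmbientSnd_π : joinAmbientSnd M₁ M₂ ≫ M₂.π = (joinAmbient M₁ M₂).hom :=
  Over.w (CartesianMonoidalCategory.snd M₁.toOver M₂.toOver)

/-- The first component of the diagonal point is `gen₁`. [folklore] -/
@[reassoc]
theorem joinPoint_fst : joinPoint M₁ M₂ ≫ joinAmbientFst M₁ M₂ = M₁.gen := by
  show (joinPointOver M₁ M₂).left ≫ (CartesianMonoidalCategory.fst M₁.toOver M₂.toOver).left =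
    (genOver M₁).left
  rw [← Over.comp_left, joinPointOver, CartesianMonoidalCategory.lift_fst]

/-- The second component of the diagonal point is `gen₂`. [folklore] -/
@[reassoc]
theorem joinPoint_snd : joinPoint M₁ M₂ ≫ joinAmbientSnd M₁ M₂ = M₂.gen := by
  show (joinPointOver M₁ M₂).left ≫ (CartesianMonoidalCategory.snd M₁.toOver M₂.toOver).left =
    (genOver M₂).left
  rw [← Over.comp_left, joinPointOver, CartesianMonoidalCategory.lift_snd]

/-- **The join** `J(M₁, M₂)` of two projective models of `K/k` (Zariski–Samuel II, Ch. VI §17;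
Piltant 2013, proof of Prop. 5.1, Step 2): the closure model of the diagonal `K`-point in
`M₁ ×ₖ M₂` — the closure of the graph of the birational correspondence `M₁ ⋯→ M₂`.
[cite: ZariskiSamuel1960, Ch. VI §17] -/
def join : ProjModel k K :=
  ofClosure M₁ (isProjectiveOver_joinAmbient M₁ M₂) (joinPoint M₁ M₂) (joinAmbientFst M₁ M₂)
    (joinAmbientFst_π M₁ M₂) (joinPoint_fst M₁ M₂)

/-- The join dominates the first model. [cite: ZariskiSamuel1960, Ch. VI §17] -/
def joinFst : (join M₁ M₂).Hom M₁ :=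
  ofClosure.homOf M₁ _ _ _ _ _ M₁ (joinAmbientFst M₁ M₂) (joinAmbientFst_π M₁ M₂)
    (joinPoint_fst M₁ M₂)

/-- The join dominates the second model. [cite: ZariskiSamuel1960, Ch. VI §17] -/
def joinSnd : (join M₁ M₂).Hom M₂ :=
  ofClosure.homOf M₁ _ _ _ _ _ M₂ (joinAmbientSnd M₁ M₂) (joinAmbientSnd_π M₁ M₂)
    (joinPoint_snd M₁ M₂)

variable {M₁ M₂}

/-- A `k`-morphism `U → M₁ ×ₖ M₂` from a `k`-scheme with given components. [folklore] -/
def liftToJoinAmbient {V : Scheme.{u}} (v : V ⟶ Spec (CommRingCat.of k)) (g₁ : V ⟶ M₁.X)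
    (g₂ : V ⟶ M₂.X) (hg₁ : g₁ ≫ M₁.π = v) (hg₂ : g₂ ≫ M₂.π = v) :
    Over.mk v ⟶ joinAmbient M₁ M₂ :=
  CartesianMonoidalCategory.lift (Over.homMk g₁ hg₁ : Over.mk v ⟶ M₁.toOver)
    (Over.homMk g₂ hg₂ : Over.mk v ⟶ M₂.toOver)

/-- The first component of `liftToJoinAmbient`. [folklore] -/
@[reassoc]
theorem liftToJoinAmbient_fst {V : Scheme.{u}} (v : V ⟶ Spec (CommRingCat.of k))
    (g₁ : V ⟶ M₁.X) (g₂ : V ⟶ M₂.X) (hg₁ : g₁ ≫ M₁.π = v) (hg₂ : g₂ ≫ M₂.π = v) :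
    (liftToJoinAmbient v g₁ g₂ hg₁ hg₂).left ≫ joinAmbientFst M₁ M₂ = g₁ := by
  show (liftToJoinAmbient v g₁ g₂ hg₁ hg₂).left ≫
      (CartesianMonoidalCategory.fst M₁.toOver M₂.toOver).left =
    (Over.homMk g₁ hg₁ : Over.mk v ⟶ M₁.toOver).left
  rw [← Over.comp_left, liftToJoinAmbient, CartesianMonoidalCategory.lift_fst]

/-- The second component of `liftToJoinAmbient`. [folklore] -/
@[reassoc]
theorem liftToJoinAmbient_snd {V : Scheme.{u}} (v : V ⟶ Spec (CommRingCat.of k))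
    (g₁ : V ⟶ M₁.X) (g₂ : V ⟶ M₂.X) (hg₁ : g₁ ≫ M₁.π = v) (hg₂ : g₂ ≫ M₂.π = v) :
    (liftToJoinAmbient v g₁ g₂ hg₁ hg₂).left ≫ joinAmbientSnd M₁ M₂ = g₂ := by
  show (liftToJoinAmbient v g₁ g₂ hg₁ hg₂).left ≫
      (CartesianMonoidalCategory.snd M₁.toOver M₂.toOver).left =
    (Over.homMk g₂ hg₂ : Over.mk v ⟶ M₂.toOver).left
  rw [← Over.comp_left, liftToJoinAmbient, CartesianMonoidalCategory.lift_snd]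

/-- **A `K`-point of `M₁ ×ₖ M₂` with components `gen₁`, `gen₂` is the diagonal point.**
[folklore] -/
theorem comp_left_eq_joinPoint {V : Scheme.{u}} (v : V ⟶ Spec (CommRingCat.of k))
    (g₁ : V ⟶ M₁.X) (g₂ : V ⟶ M₂.X) (hg₁ : g₁ ≫ M₁.π = v) (hg₂ : g₂ ≫ M₂.π = v)
    (sV : Spec (CommRingCat.of K) ⟶ V) (h₁ : sV ≫ g₁ = M₁.gen) (h₂ : sV ≫ g₂ = M₂.gen) :
    sV ≫ (liftToJoinAmbient v g₁ g₂ hg₁ hg₂).left = joinPoint M₁ M₂ := by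
  have hsO : sV ≫ (Over.mk v).hom = (specOverK k K).hom := by
    show sV ≫ v = Spec.map (CommRingCat.ofHom (algebraMap k K))
    rw [← hg₁, reassoc_of% h₁, M₁.gen_π]
  let σ : specOverK k K ⟶ Over.mk v := Over.homMk sV hsO
  show (σ ≫ liftToJoinAmbient v g₁ g₂ hg₁ hg₂).left = (joinPointOver M₁ M₂).left
  congr 1
  apply CartesianMonoidalCategory.hom_ext
  · simp only [Category.assoc, liftToJoinAmbient, joinPointOver,
      CartesianMonoidalCategory.lift_fst]
    ext
    exact h₁
  · simp only [Category.assoc, liftToJoinAmbient, joinPointOver,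
      CartesianMonoidalCategory.lift_snd]
    ext
    exact h₂

/-- **The join is isomorphic to `M₁` over the domain of definition of `M₁ ⋯→ M₂`** (Piltant 2013,
Lemma 3.3 and proof of Prop. 5.1, Step 5; Zariski–Samuel II, Ch. VI §17): if over the open
`U ⊆ M₁` the birational correspondence is a `k`-morphism `f₂ : U → M₂` compatible with the
`K`-points (`sU ≫ U.ι = gen₁`, `sU ≫ f₂ = gen₂` for a `K`-point `sU` of `U`), then
`J(M₁, M₂) → M₁` is an isomorphism over `U`. [cite: Piltant2013, Lemma 3.3] -/
theorem isIso_joinFst_morphismRestrict (U : M₁.X.Opens) (f₂ : (U : Scheme.{u}) ⟶ M₂.X)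
    (hf₂ : f₂ ≫ M₂.π = U.ι ≫ M₁.π) (sU : Spec (CommRingCat.of K) ⟶ U)
    (h₁ : sU ≫ U.ι = M₁.gen) (h₂ : sU ≫ f₂ = M₂.gen) : IsIso ((joinFst M₁ M₂).f ∣_ U) := by
  let f : (U : Scheme.{u}) ⟶ (joinAmbient M₁ M₂).left :=
    (liftToJoinAmbient (U.ι ≫ M₁.π) U.ι f₂ rfl hf₂).left
  have hf : f ≫ joinAmbientFst M₁ M₂ = U.ι := liftToJoinAmbient_fst _ _ _ _ _
  have hsU : sU ≫ f = joinPoint M₁ M₂ := comp_left_eq_joinPoint _ _ _ _ _ sU h₁ h₂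
  exact ofClosure.isIso_homOf_morphismRestrict M₁ _ _ _ _ _ M₁ _ _ _ U f hf sU hsU

/-- Symmetrically, **the join is isomorphic to `M₂` over the domain of definition of
`M₂ ⋯→ M₁`**. [cite: Piltant2013, Lemma 3.3] -/
theorem isIso_joinSnd_morphismRestrict (U : M₂.X.Opens) (f₁ : (U : Scheme.{u}) ⟶ M₁.X)
    (hf₁ : f₁ ≫ M₁.π = U.ι ≫ M₂.π) (sU : Spec (CommRingCat.of K) ⟶ U)
    (h₂ : sU ≫ U.ι = M₂.gen) (h₁ : sU ≫ f₁ = M₁.gen) : IsIso ((joinSnd M₁ M₂).f ∣_ U) := by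
  let f : (U : Scheme.{u}) ⟶ (joinAmbient M₁ M₂).left :=
    (liftToJoinAmbient (U.ι ≫ M₂.π) f₁ U.ι hf₁ rfl).left
  have hf : f ≫ joinAmbientSnd M₁ M₂ = U.ι := liftToJoinAmbient_snd _ _ _ _ _
  have hsU : sU ≫ f = joinPoint M₁ M₂ := comp_left_eq_joinPoint _ _ _ _ _ sU h₁ h₂
  exact ofClosure.isIso_homOf_morphismRestrict M₁ _ _ _ _ _ M₂ _ _ _ U f hf sU hsU

end Join

end ProjModel

end Literature.AlgebraicGeometry.Resolution

end
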